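import Literature.Barriers.CriticalPhenomena.PlaquetteWalkDominoRigidity
import HarnessLib

/-!
# Barrier catalogue (SAWScalingLimit): the VERTICAL domino technique class of the five-weight plaquette walk
on `ℤ²` — definitions, the six vertical two-plaquette rows, their necessity, and generic triviality

The vertical twin of `PlaquetteWalkDominoRigidity` (walk-free half; the identities on the directed branches
are `PlaquetteWalkDominoIdentityVertical`). The vertical domino `{f, f↑ = f + (0,1)}` has its seven sides in
the slot order `(f.S, f.W, f.E, shared = f.N = f↑.S, f↑.W, f↑.E, f↑.N) ↦ (0, …, 6)`; a relation is
`Σ_s c_s F(z_s) = 0` with a CONSTANT `c ∈ ℂ⁷` at every vertical domino of every finite face list for every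
boundary root: `ExactDominoVertexRelationV W t c`.

* § Definitions and rows (`dominoSlotV`, `dominoFunctionalV`, splitting `dominoFunctionalV_eq_add`,
  `DominoRowsV`), closed forms on the branches (the HORIZONTAL branch vectors serve the vertical dominoes of
  the OPPOSITE branch: `dominoRowsV_branch` / `dominoRowsV_mirrorBranch`).
* § Necessity: ★ `dominoRowsV_of_exactDominoVertexRelationV` — for every `W ∈ ℂ⁵`, `t ≠ 0` an exact vertical
  domino relation forces the six vertical rows (bare vertical domino `[(0,0),(0,1)]`, six boundary roots;
  twelve `decide` instances of the certified enumerator).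
* § Generic triviality: under the half-turn of the vertical domino (`0 ↔ 6`, `1 ↔ 5`, `2 ↔ 4`) the cleared
  rows give a `3 × 3` antisymmetric system whose determinant is `t² · dominoDetAV` with ★ `dominoDetAV` =
  LITERALLY the horizontal polynomial `dominoDetA` (`dominoDetAV_eq_dominoDetA`), and — with one `2 × 2`-block
  instance (south side of `(0,0)` in `[(0,0),(0,1),(1,0),(1,1)]`) and its half-turn image — a `4 × 4`
  symmetric system with determinant `2u₁²u₂t⁵ · dominoDetSV` (21 terms; `dominoDetSV` is `dominoDetS` read at
  `t⁻¹` and cleared). ★★ `eq_zero_of_exactDominoVertexRelationV`: `u₁u₂ ≠ 0`, `t ≠ 0`, `dominoDetAV ≠ 0`,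
  `dominoDetSV ≠ 0` ⇒ every exact vertical domino relation is trivial; ★★ named
  `PlaquetteWalkDominoGenericTrivialityVertical(_holds)`; `PlaquetteWalkDominoRowsVertical(_holds)`.

Sources: [cite: GlazmanManolescu2019, §1 Fig. 1,
    eq. (1); §2.1; Lemma 2.1]; [cite: Glazman2015WeightedSAW,
Lemma 3.1 (proof: the one-rhombus linear system,
    "solving this linear system")]; [cite: IkhlefCardy2009, §3
(determinant of the local linear system)]; [cite: DuminilCopinSmirnov2012, Lemma 1]; [cite:
JansevanRensburg2015, §4.6 (Temperley method, eq. (4.197), Fig. 4.24)]. Status in print: as for the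
horizontal file — the typed vertical rows/determinants/necessity/generic triviality are the venture lane's
(«pcv-sawmu», Tier B SEARCH 1,
    b-engine-1 gen 14) — NEW-IN-WRITING (modest) for the typed vertical determinants / generic triviality,
CONSOLIDATION AT KERNEL RIGOUR for the rows (label of the lane's literature desk, 2026-08-24, the vertical twin of
`PlaquetteWalkDominoRigidity`'s). Editions: ed.1 (lane bank) → ed.2 = this file's first tree edition (proposal
p377120, 2026-08-24; the `GlazmanManolescu2019, Lemma 2.1 (statement …)` / `Glazman2015WeightedSAW, Lemma 3.1
(proof …)` locator split). Sequels in the lane importing this file: `PlaquetteWalkDominoIdentityVertical` (the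
vertical domino identities of the directed branches) and `PlaquetteWalkDominoSAWNoGoVertical` (the uniform
self-avoiding walk carries no vertical two-plaquette identity). Not claimed: anything on the exceptional hypersurface. Implementation: `vertexFunctional_mul_pow_eq_rowSumN` is
private in `PlaquetteWalkSpinRigidity` (read via `open private`).
-/

noncomputable section

open Complex

namespace Literature.Barriers.CriticalPhenomena

open Literature.Probability.RandomPlanarGeometry.SAW.YangBaxter

namespace PlaquetteWalk

open private vertexFunctional_mul_pow_eq_rowSumN from
  Literature.Barriers.CriticalPhenomena.PlaquetteWalkSpinRigidity

/-! ### The vertical domino: slots, functional, technique class -/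

/-- The northern neighbour `f↑ = f + (0, 1)` of a plaquette. [cite: GlazmanManolescu2019, §1 (rows j, j+1)] -/
def north (f : Face) : Face := (f.1, f.2 + 1)

/-- The vertical shared side: the north side of `f` is the south side of `f↑`. [cite: GlazmanManolescu2019, §1 ("slant k j is the bottom side of face (k, j), the top side of (k, j−1)")] -/
theorem side_N_eq_north_side_S (f : Face) : f.side .N = (north f).side .S := rfl

/-- The seven sides of the vertical domino `{f, f↑}` in slot order
`(f.S, f.W, f.E, shared, f↑.W, f↑.E, f↑.N) ↦ (0, 1, 2, 3, 4, 5, 6)`. [cite: GlazmanManolescu2019, §2.1, Fig. 4 (z_W, z_E, z_S, z_N of a rhombus)] -/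
def dominoSlotV (f : Face) : Fin 7 → MidEdge :=
  ![f.side .S, f.side .W, f.side .E, f.side .N, (north f).side .W, (north f).side .E,
      (north f).side .N]

/-- **The vertical domino functional** `Σ_{s < 7} c_s F(z_s)`. [cite: DuminilCopinSmirnov2012, Lemma 1 (shape of a local linear relation among observable values)] -/
def dominoFunctionalV (W : CWeights) (t : ℂ) (c : Fin 7 → ℂ) (Dl : List Face) (a : MidEdge) (f : Face) : ℂ :=
  ∑ s : Fin 7, c s * gmObservable W t Dl a (dominoSlotV f s)

/-- **Technique class** `ExactDominoVertexRelationV W t c`: the vertical-domino relation with CONSTANT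
coefficients `c ∈ ℂ⁷` at EVERY vertical domino `{f, f↑} ⊆ D` of EVERY finite face list for EVERY boundary
root (hole roots included). [cite: GlazmanManolescu2019,
    Lemma 2.1 (shape: a relation at each rhombus — here at each pair of vertically adjacent rhombi)] -/
def ExactDominoVertexRelationV (W : CWeights) (t : ℂ) (c : Fin 7 → ℂ) : Prop :=
  ∀ (Dl : List Face) (a : MidEdge) (f : Face), f ∈ Dl → north f ∈ Dl → IsBoundaryRoot Dl a →
    dominoFunctionalV W t c Dl a f = 0

/-- Lower one-plaquette vector `(c_E, γ₁, c_W, c_S)` (slot order `(E, N, W, S)` at `f`; `N` = shared). [cite: GlazmanManolescu2019, §2.1 (walks of a finite domain started at a boundary mid-edge)] -/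
def downCoeff (c : Fin 7 → ℂ) (γ₁ : ℂ) : Fin 4 → ℂ := ![c 2, γ₁, c 1, c 0]

/-- Upper one-plaquette vector `(c_E↑, c_N↑, c_W↑, γ₂)` (slot order `(E, N, W, S)` at `f↑`; `S` = shared). [cite: GlazmanManolescu2019, §2.1 (walks of a finite domain started at a boundary mid-edge)] -/
def upCoeff (c : Fin 7 → ℂ) (γ₂ : ℂ) : Fin 4 → ℂ := ![c 5, c 6, c 4, γ₂]

/-- ★ **Splitting**: for any `γ₁ + γ₂ = c_shared`, the vertical domino functional is the vertex functional of
`downCoeff c γ₁` at `f` plus that of `upCoeff c γ₂` at `f↑`. [cite: DuminilCopinSmirnov2012, Lemma 1 (linear in the coefficients)] -/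
theorem dominoFunctionalV_eq_add (W : CWeights) (t : ℂ) (c : Fin 7 → ℂ) (Dl : List Face) (a : MidEdge)
    (f : Face) {γ₁ γ₂ : ℂ} (h : γ₁ + γ₂ = c 3) :
    dominoFunctionalV W t c Dl a f =
      vertexFunctional W t (downCoeff c γ₁) Dl a f
          + vertexFunctional W t (upCoeff c γ₂) Dl a (north f) := by
  rw [vertexFunctional_eq_sum_sides, vertexFunctional_eq_sum_sides, dominoFunctionalV,
      Fin.sum_univ_seven,
    show (Finset.univ : Finset Side) = {Side.E, Side.N, Side.W, Side.S} from by decide,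
    Finset.sum_insert (by decide), Finset.sum_insert (by decide), Finset.sum_insert (by decide),
    Finset.sum_singleton, Finset.sum_insert (by decide), Finset.sum_insert (by decide),
    Finset.sum_insert (by decide), Finset.sum_singleton, ← side_N_eq_north_side_S, ← h]
  simp only [dominoSlotV, downCoeff, upCoeff, slotIdx, Matrix.cons_val_zero, Matrix.cons_val_one,
    Matrix.head_cons, Matrix.cons_val_two, Matrix.tail_cons, Matrix.cons_val_three, Matrix.cons_val]
  ring

/-- **Translates**: two one-plaquette relations at `f` and `f↑` give a vertical domino relation.
[cite: GlazmanManolescu2019, Lemma 2.1] -/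
theorem exactDominoVertexRelationV_of_plaquette {W : CWeights} {t : ℂ} {c : Fin 7 → ℂ} {γ₁ γ₂ : ℂ}
    (h : γ₁ + γ₂ = c 3) (hD : ExactPlaquetteVertexRelation W t (downCoeff c γ₁))
    (hU : ExactPlaquetteVertexRelation W t (upCoeff c γ₂)) : ExactDominoVertexRelationV W t c := by
  intro Dl a f hf hf' ha
  rw [dominoFunctionalV_eq_add W t c Dl a f h, hD Dl a f hf ha, hU Dl a (north f) hf' ha, add_zero]

/-! ### The six vertical two-plaquette rows -/

/-- The inner row entering `f↑` through the shared side (its `S` side). [cite: Glazman2015WeightedSAW, Lemma 3.1 (proof, eq. (3.11))] -/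
def innerUp (W : CWeights) (t : ℂ) (c : Fin 7 → ℂ) : ℂ := plaqRow W t ![c 5, c 6, c 4, c 3] .S

/-- The inner row entering `f` through the shared side (its `N` side). [cite: Glazman2015WeightedSAW, Lemma 3.1 (proof, eq. (3.11))] -/
def innerDown (W : CWeights) (t : ℂ) (c : Fin 7 → ℂ) : ℂ := plaqRow W t ![c 2, c 3, c 1, c 0] .N

/-- The dressed lower vector `(c_E, innerUp, c_W, c_S)`. [cite: GlazmanManolescu2019, §2.1 (walks of a finite domain started at a boundary mid-edge)] -/
def dressDown (W : CWeights) (t : ℂ) (c : Fin 7 → ℂ) : Fin 4 → ℂ := ![c 2, innerUp W t c, c 1, c 0]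

/-- The dressed upper vector `(c_E↑, c_N↑, c_W↑, innerDown)`. [cite: GlazmanManolescu2019, §2.1 (walks of a finite domain started at a boundary mid-edge)] -/
def dressUp (W : CWeights) (t : ℂ) (c : Fin 7 → ℂ) : Fin 4 → ℂ := ![c 5, c 6, c 4, innerDown W t c]

/-- **The six vertical two-plaquette rows**: the rows of the dressed lower vector at the three outer sides
`S, W, E` of `f` and of the dressed upper vector at the three outer sides `W, E, N` of `f↑`.
[cite: GlazmanManolescu2019, Lemma 2.1 (statement, "in the form given in [Gl]")] [cite: Glazman2015WeightedSAW, Lemma 3.1 (proof: grouping the walks by their behaviour outside a rhombus)] -/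
def DominoRowsV (W : CWeights) (t : ℂ) (c : Fin 7 → ℂ) : Prop :=
  plaqRow W t (dressDown W t c) .S = 0 ∧ plaqRow W t (dressDown W t c) .W = 0 ∧
    plaqRow W t (dressDown W t c) .E = 0 ∧ plaqRow W t (dressUp W t c) .W = 0 ∧
    plaqRow W t (dressUp W t c) .E = 0 ∧ plaqRow W t (dressUp W t c) .N = 0

section Rows

variable {W : CWeights} {t : ℂ}

/-- The six vertical rows on `u₁ = 0`, written out (`c = (c₀, …, c₆)`):
`R_S = c₀ + u₂t c₁ + v c₃ + v² c₆ + u₂ v t c₄`, `R_W = c₁ + v c₂ + u₂ t⁻¹ c₀`,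
`R_E = c₂ + v c₁ + u₂ t⁻¹ c₃ + u₂ v t⁻¹ c₆ + u₂² c₄`, `R_W↑ = c₄ + v c₅ + u₂ t⁻¹ c₃ + u₂ v t⁻¹ c₀ + u₂² c₂`,
`R_E↑ = c₅ + v c₄ + u₂ t⁻¹ c₆`, `R_N↑ = c₆ + u₂ t c₅ + v c₃ + v² c₀ + u₂ v t c₂`. [cite: Glazman2015WeightedSAW, Lemma 3.1 (proof: "solving this linear system")] -/
theorem dominoRowsV_iff_of_u₁_eq_zero (ht : t ≠ 0) (h1 : W.u₁ = 0) (c : Fin 7 → ℂ) :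
    DominoRowsV W t c ↔
      (c 0 + W.u₂ * t * c 1 + W.v * c 3 + W.v ^ 2 * c 6 + W.u₂ * W.v * t * c 4 = 0 ∧
        c 1 + W.v * c 2 + W.u₂ * t⁻¹ * c 0 = 0 ∧
        c 2 + W.v * c 1 + W.u₂ * t⁻¹ * c 3 + W.u₂ * W.v * t⁻¹ * c 6 + W.u₂ ^ 2 * c 4 = 0 ∧
        c 4 + W.v * c 5 + W.u₂ * t⁻¹ * c 3 + W.u₂ * W.v * t⁻¹ * c 0 + W.u₂ ^ 2 * c 2 = 0 ∧
        c 5 + W.v * c 4 + W.u₂ * t⁻¹ * c 6 = 0 ∧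
        c 6 + W.u₂ * t * c 5 + W.v * c 3 + W.v ^ 2 * c 0 + W.u₂ * W.v * t * c 2 = 0) := by
  have e : ∀ (d : Fin 4 → ℂ) (p : Side),
      plaqRow W t d p = d 2 * arcW W (arcKind p .W) * t ^ qTurn p .W +
      d 0 * arcW W (arcKind p .E) * t ^ qTurn p .E + d 3 * arcW W (arcKind p .S) * t ^ qTurn p .S +
      d 1 * arcW W (arcKind p .N) * t ^ qTurn p .N := plaqRow_eq W t
  have hti : t * t⁻¹ = 1 := mul_inv_cancel₀ ht
  simp only [DominoRowsV, dressDown, dressUp, innerUp, innerDown, e, arcKind, arcW, qTurn, h1,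
    Matrix.cons_val_zero, Matrix.cons_val_one, Matrix.head_cons, Matrix.cons_val_two,
        Matrix.tail_cons,
    Matrix.cons_val_three, zpow_zero, zpow_one, zpow_neg, mul_one, mul_zero, zero_mul, add_zero,
        zero_add,
    Int.reduceNeg]
  constructor
  · rintro ⟨hS, hW, hE, hW', hE', hN'⟩
    refine ⟨?_, ?_, ?_, ?_, ?_, ?_⟩
    · linear_combination hS
    · linear_combination hW
    · linear_combination hE + (-(W.u₂ ^ 2 * c 4)) * hti
    · linear_combination hW' + (-(W.u₂ ^ 2 * c 2)) * hti
    · linear_combination hE'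
    · linear_combination hN'
  · rintro ⟨hS, hW, hE, hW', hE', hN'⟩
    refine ⟨?_, ?_, ?_, ?_, ?_, ?_⟩
    · linear_combination hS
    · linear_combination hW
    · linear_combination hE + (c 4 * W.u₂ ^ 2) * hti
    · linear_combination hW' + (c 2 * W.u₂ ^ 2) * hti
    · linear_combination hE'
    · linear_combination hN'

/-- The six vertical rows on `u₂ = 0`, written out:
`R_S = c₀ + u₁ t⁻¹ c₂ + v c₃ + v² c₆ + u₁ v t⁻¹ c₅`, `R_W = c₁ + v c₂ + u₁ t c₃ + u₁ v t c₆ + u₁² c₅`,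
`R_E = c₂ + v c₁ + u₁ t c₀`, `R_W↑ = c₄ + v c₅ + u₁ t c₆`,
`R_E↑ = c₅ + v c₄ + u₁ t c₃ + u₁ v t c₀ + u₁² c₁`, `R_N↑ = c₆ + u₁ t⁻¹ c₄ + v c₃ + v² c₀ + u₁ v t⁻¹ c₁`. [cite: Glazman2015WeightedSAW, Lemma 3.1 (proof: "solving this linear system")] -/
theorem dominoRowsV_iff_of_u₂_eq_zero (ht : t ≠ 0) (h2 : W.u₂ = 0) (c : Fin 7 → ℂ) :
    DominoRowsV W t c ↔
      (c 0 + W.u₁ * t⁻¹ * c 2 + W.v * c 3 + W.v ^ 2 * c 6 + W.u₁ * W.v * t⁻¹ * c 5 = 0 ∧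
        c 1 + W.v * c 2 + W.u₁ * t * c 3 + W.u₁ * W.v * t * c 6 + W.u₁ ^ 2 * c 5 = 0 ∧
        c 2 + W.v * c 1 + W.u₁ * t * c 0 = 0 ∧
        c 4 + W.v * c 5 + W.u₁ * t * c 6 = 0 ∧
        c 5 + W.v * c 4 + W.u₁ * t * c 3 + W.u₁ * W.v * t * c 0 + W.u₁ ^ 2 * c 1 = 0 ∧
        c 6 + W.u₁ * t⁻¹ * c 4 + W.v * c 3 + W.v ^ 2 * c 0 + W.u₁ * W.v * t⁻¹ * c 1 = 0) := by
  have e : ∀ (d : Fin 4 → ℂ) (p : Side),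
      plaqRow W t d p = d 2 * arcW W (arcKind p .W) * t ^ qTurn p .W +
      d 0 * arcW W (arcKind p .E) * t ^ qTurn p .E + d 3 * arcW W (arcKind p .S) * t ^ qTurn p .S +
      d 1 * arcW W (arcKind p .N) * t ^ qTurn p .N := plaqRow_eq W t
  have hti : t * t⁻¹ = 1 := mul_inv_cancel₀ ht
  simp only [DominoRowsV, dressDown, dressUp, innerUp, innerDown, e, arcKind, arcW, qTurn, h2,
    Matrix.cons_val_zero, Matrix.cons_val_one, Matrix.head_cons, Matrix.cons_val_two,
        Matrix.tail_cons,
    Matrix.cons_val_three, zpow_zero, zpow_one, zpow_neg, mul_one, mul_zero, zero_mul, add_zero,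
        zero_add,
    Int.reduceNeg]
  constructor
  · rintro ⟨hS, hW, hE, hW', hE', hN'⟩
    refine ⟨?_, ?_, ?_, ?_, ?_, ?_⟩
    · linear_combination hS
    · linear_combination hW + (-(W.u₁ ^ 2 * c 5)) * hti
    · linear_combination hE
    · linear_combination hW'
    · linear_combination hE' + (-(W.u₁ ^ 2 * c 1)) * hti
    · linear_combination hN'
  · rintro ⟨hS, hW, hE, hW', hE', hN'⟩
    refine ⟨?_, ?_, ?_, ?_, ?_, ?_⟩
    · linear_combination hS
    · linear_combination hW + (c 5 * W.u₁ ^ 2) * hti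
    · linear_combination hE
    · linear_combination hW'
    · linear_combination hE' + (c 1 * W.u₁ ^ 2) * hti
    · linear_combination hN'

/-- ★ On `u₁ = 0` the HORIZONTAL MIRROR vector `branchDominoCoeffMirror u₂ v t` kills the six vertical rows
(the diagonal reflection exchanges the two orientations and the two corner kinds). [cite: Glazman2015WeightedSAW, Lemma 3.1 (proof: "solving this linear system")] -/
theorem dominoRowsV_branch (ht : t ≠ 0) (h1 : W.u₁ = 0) :
    DominoRowsV W t (branchDominoCoeffMirror W.u₂ W.v t) := by
  rw [dominoRowsV_iff_of_u₁_eq_zero ht h1]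
  have hti : t * t⁻¹ = 1 := mul_inv_cancel₀ ht
  simp only [branchDominoCoeffMirror, Matrix.cons_val_zero, Matrix.cons_val_one, Matrix.head_cons,
    Matrix.cons_val_two, Matrix.tail_cons, Matrix.cons_val_three, Matrix.cons_val]
  refine ⟨?_, ?_, ?_, ?_, ?_, ?_⟩
  · ring
  · linear_combination (W.u₂ * W.v * (W.u₂ ^ 2 - W.v ^ 2 + 1)) * hti
  · linear_combination (W.u₂ * ((W.u₂ ^ 2 - W.v ^ 2 - 1) * (W.u₂ ^ 2 - W.v ^ 2 + 1) +
      W.v ^ 2 * (W.u₂ ^ 2 - W.v ^ 2 + 1))) * hti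
  · linear_combination (W.u₂ * ((W.u₂ ^ 2 - W.v ^ 2 - 1) * (W.u₂ ^ 2 - W.v ^ 2 + 1) +
      W.v ^ 2 * (W.u₂ ^ 2 - W.v ^ 2 + 1))) * hti
  · linear_combination (W.u₂ * W.v * (W.u₂ ^ 2 - W.v ^ 2 + 1)) * hti
  · ring

/-- ★ On `u₂ = 0` the HORIZONTAL vector `branchDominoCoeff u₁ v t` kills the six vertical rows.
[cite: Glazman2015WeightedSAW, Lemma 3.1 (proof: "solving this linear system")] -/
theorem dominoRowsV_mirrorBranch (ht : t ≠ 0) (h2 : W.u₂ = 0) :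
    DominoRowsV W t (branchDominoCoeff W.u₁ W.v t) := by
  rw [dominoRowsV_iff_of_u₂_eq_zero ht h2]
  have hti : t * t⁻¹ = 1 := mul_inv_cancel₀ ht
  simp only [branchDominoCoeff, Matrix.cons_val_zero, Matrix.cons_val_one, Matrix.head_cons,
    Matrix.cons_val_two, Matrix.tail_cons, Matrix.cons_val_three, Matrix.cons_val]
  refine ⟨?_, ?_, ?_, ?_, ?_, ?_⟩
  · linear_combination (-(2 * W.u₁ ^ 2 * W.v) - W.u₁ ^ 2 * W.v * (W.u₁ ^ 2 - W.v ^ 2 - 1)) * hti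
  · ring
  · ring
  · ring
  · ring
  · linear_combination (-(2 * W.u₁ ^ 2 * W.v) - W.u₁ ^ 2 * W.v * (W.u₁ ^ 2 - W.v ^ 2 - 1)) * hti

end Rows

/-! ## Necessity of the six vertical rows (every weight system) -/

section NecessityV

variable {W : CWeights} {t : ℂ} {c : Fin 7 → ℂ}

/-- The bare vertical domino. [cite: GlazmanManolescu2019, §1 (faces (k, j))] -/
def domV : List Face := [(0, 0), (0, 1)]

/-- The relation on the bare vertical domino, split into the two one-plaquette functionals. [cite: DuminilCopinSmirnov2012, Lemma 1 (linear in the coefficients)] -/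
private theorem split_domV (hrel : ExactDominoVertexRelationV W t c) {a : MidEdge}
    (ha : IsBoundaryRoot domV a) :
    vertexFunctional W t (downCoeff c (c 3)) domV a (0, 0) +
      vertexFunctional W t (upCoeff c 0) domV a (0, 1) = 0 := by
  have h := hrel domV a (0, 0) (by simp [domV]) (by simp [domV, north]) ha
  rwa [dominoFunctionalV_eq_add W t c domV a (0, 0) (show c 3 + 0 = c 3 by ring)] at h

/-- The vertical row at the south side of `f`, cleared by `t²`. [cite: Glazman2015WeightedSAW, Lemma 3.1 (proof: "solving this linear system")] -/
private theorem rowVS_mul (ht : t ≠ 0) : plaqRow W t (dressDown W t c) .S * t ^ 2 =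
    c 0 * t ^ 2 + c 1 * W.u₂ * t ^ 3 + c 2 * W.u₁ * t + c 3 * W.v * t ^ 2
        + c 4 * W.u₂ * W.v * t ^ 3 + c 5 * W.u₁ * W.v * t + c 6 * W.v ^ 2 * t ^ 2 := by
  have hti : t * t⁻¹ = 1 := mul_inv_cancel₀ ht
  rw [plaqRow_eq, dressDown, innerUp, plaqRow_eq]
  simp only [arcKind, arcW, qTurn, Matrix.cons_val_zero, Matrix.cons_val_one, Matrix.head_cons,
    Matrix.cons_val_two, Matrix.tail_cons, Matrix.cons_val_three, zpow_zero, zpow_one, zpow_neg,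
        mul_one,
    Int.reduceNeg]
  linear_combination (c 2 * W.u₁ * t + c 5 * W.u₁ * W.v * t) * hti

/-- The vertical row at the west side of `f`, cleared by `t²`. [cite: Glazman2015WeightedSAW, Lemma 3.1 (proof: "solving this linear system")] -/
private theorem rowVW_mul (ht : t ≠ 0) : plaqRow W t (dressDown W t c) .W * t ^ 2 =
    c 0 * W.u₂ * t + c 1 * t ^ 2 + c 2 * W.v * t ^ 2 + c 3 * W.u₁ * t ^ 3
        + c 4 * W.u₁ * W.u₂ * t ^ 4 + c 5 * W.u₁ ^ 2 * t ^ 2 + c 6 * W.u₁ * W.v * t ^ 3 := by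
  have hti : t * t⁻¹ = 1 := mul_inv_cancel₀ ht
  rw [plaqRow_eq, dressDown, innerUp, plaqRow_eq]
  simp only [arcKind, arcW, qTurn, Matrix.cons_val_zero, Matrix.cons_val_one, Matrix.head_cons,
    Matrix.cons_val_two, Matrix.tail_cons, Matrix.cons_val_three, zpow_zero, zpow_one, zpow_neg,
        mul_one,
    Int.reduceNeg]
  linear_combination (c 0 * W.u₂ * t + c 5 * W.u₁ ^ 2 * t ^ 2) * hti

/-- The vertical row at the east side of `f`, cleared by `t²`. [cite: Glazman2015WeightedSAW, Lemma 3.1 (proof: "solving this linear system")] -/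
private theorem rowVE_mul (ht : t ≠ 0) : plaqRow W t (dressDown W t c) .E * t ^ 2 =
    c 0 * W.u₁ * t ^ 3 + c 1 * W.v * t ^ 2 + c 2 * t ^ 2 + c 3 * W.u₂ * t
        + c 4 * W.u₂ ^ 2 * t ^ 2 + c 5 * W.u₁ * W.u₂ + c 6 * W.u₂ * W.v * t := by
  have hti : t * t⁻¹ = 1 := mul_inv_cancel₀ ht
  rw [plaqRow_eq, dressDown, innerUp, plaqRow_eq]
  simp only [arcKind, arcW, qTurn, Matrix.cons_val_zero, Matrix.cons_val_one, Matrix.head_cons,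
    Matrix.cons_val_two, Matrix.tail_cons, Matrix.cons_val_three, zpow_zero, zpow_one, zpow_neg,
        mul_one,
    Int.reduceNeg]
  linear_combination (c 3 * W.u₂ * t + c 4 * W.u₂ ^ 2 * t ^ 2 + c 5 * W.u₁ * W.u₂
      + c 5 * W.u₁ * W.u₂ * t * t⁻¹ + c 6 * W.u₂ * W.v * t) * hti

/-- The vertical row at the west side of `f↑`, cleared by `t²`. [cite: Glazman2015WeightedSAW, Lemma 3.1 (proof: "solving this linear system")] -/
private theorem rowUW_mul (ht : t ≠ 0) : plaqRow W t (dressUp W t c) .W * t ^ 2 =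
    c 0 * W.u₂ * W.v * t + c 1 * W.u₁ * W.u₂ + c 2 * W.u₂ ^ 2 * t ^ 2 + c 3 * W.u₂ * t
        + c 4 * t ^ 2 + c 5 * W.v * t ^ 2 + c 6 * W.u₁ * t ^ 3 := by
  have hti : t * t⁻¹ = 1 := mul_inv_cancel₀ ht
  rw [plaqRow_eq, dressUp, innerDown, plaqRow_eq]
  simp only [arcKind, arcW, qTurn, Matrix.cons_val_zero, Matrix.cons_val_one, Matrix.head_cons,
    Matrix.cons_val_two, Matrix.tail_cons, Matrix.cons_val_three, zpow_zero, zpow_one, zpow_neg,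
        mul_one,
    Int.reduceNeg]
  linear_combination (c 0 * W.u₂ * W.v * t + c 1 * W.u₁ * W.u₂ + c 1 * W.u₁ * W.u₂ * t * t⁻¹
      + c 2 * W.u₂ ^ 2 * t ^ 2 + c 3 * W.u₂ * t) * hti

/-- The vertical row at the east side of `f↑`, cleared by `t²`. [cite: Glazman2015WeightedSAW, Lemma 3.1 (proof: "solving this linear system")] -/
private theorem rowUE_mul (ht : t ≠ 0) : plaqRow W t (dressUp W t c) .E * t ^ 2 =
    c 0 * W.u₁ * W.v * t ^ 3 + c 1 * W.u₁ ^ 2 * t ^ 2 + c 2 * W.u₁ * W.u₂ * t ^ 4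
        + c 3 * W.u₁ * t ^ 3 + c 4 * W.v * t ^ 2 + c 5 * t ^ 2 + c 6 * W.u₂ * t := by
  have hti : t * t⁻¹ = 1 := mul_inv_cancel₀ ht
  rw [plaqRow_eq, dressUp, innerDown, plaqRow_eq]
  simp only [arcKind, arcW, qTurn, Matrix.cons_val_zero, Matrix.cons_val_one, Matrix.head_cons,
    Matrix.cons_val_two, Matrix.tail_cons, Matrix.cons_val_three, zpow_zero, zpow_one, zpow_neg,
        mul_one,
    Int.reduceNeg]
  linear_combination (c 1 * W.u₁ ^ 2 * t ^ 2 + c 6 * W.u₂ * t) * hti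

/-- The vertical row at the north side of `f↑`, cleared by `t²`. [cite: Glazman2015WeightedSAW, Lemma 3.1 (proof: "solving this linear system")] -/
private theorem rowUN_mul (ht : t ≠ 0) : plaqRow W t (dressUp W t c) .N * t ^ 2 =
    c 0 * W.v ^ 2 * t ^ 2 + c 1 * W.u₁ * W.v * t + c 2 * W.u₂ * W.v * t ^ 3 + c 3 * W.v * t ^ 2
        + c 4 * W.u₁ * t + c 5 * W.u₂ * t ^ 3 + c 6 * t ^ 2 := by
  have hti : t * t⁻¹ = 1 := mul_inv_cancel₀ ht
  rw [plaqRow_eq, dressUp, innerDown, plaqRow_eq]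
  simp only [arcKind, arcW, qTurn, Matrix.cons_val_zero, Matrix.cons_val_one, Matrix.head_cons,
    Matrix.cons_val_two, Matrix.tail_cons, Matrix.cons_val_three, zpow_zero, zpow_one, zpow_neg,
        mul_one,
    Int.reduceNeg]
  linear_combination (c 1 * W.u₁ * W.v * t + c 4 * W.u₁ * t) * hti

/-! #### The six instances on the bare vertical domino (kernel enumeration by `decide`) -/

/-- Instance on the bare vertical domino at the `S` side of `(0, 0)`: 4 + 4 walks. [cite: GlazmanManolescu2019, Lemma 2.1 (statement, "in the form given in [Gl]")] [cite: Glazman2015WeightedSAW, Lemma 3.1 (proof: the walks at one rhombus)] -/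
private theorem instVS (hrel : ExactDominoVertexRelationV W t c) (ht : t ≠ 0) :
    plaqRow W t (dressDown W t c) .S = 0 := by
  have hT1 : termsN domV (Face.side (0, 0) .S) (0, 0) (depth domV) 2 =
      [⟨3, 0, 0, 0, 0, 0, 2⟩, ⟨2, 0, 1, 0, 0, 0, 3⟩, ⟨0, 1, 0, 0, 0, 0, 1⟩, ⟨1, 0, 0, 1, 0, 0,
          2⟩] := by
    decide
  have hT2 : termsN domV (Face.side (0, 0) .S) (0, 1) (depth domV) 2 =
      [⟨3, 0, 0, 1, 0, 0, 2⟩, ⟨2, 0, 1, 1, 0, 0, 3⟩, ⟨0, 1, 0, 1, 0, 0, 1⟩, ⟨1, 0, 0, 2, 0, 0,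
          2⟩] := by
    decide
  have h1 := vertexFunctional_mul_pow_eq_rowSumN W ht (downCoeff c (c 3)) domV (Face.side (0,
      0) .S) (0, 0) 2
    (by decide)
  have h2 := vertexFunctional_mul_pow_eq_rowSumN W ht (upCoeff c 0) domV (Face.side (0,
      0) .S) (0, 1) 2
    (by decide)
  have h := split_domV hrel (a := Face.side (0, 0) .S) (by decide)
  have h' : vertexFunctional W t (downCoeff c (c 3)) domV (Face.side (0, 0) .S) (0, 0) * t ^ 2 +
      vertexFunctional W t (upCoeff c 0) domV (Face.side (0, 0) .S) (0, 1) * t ^ 2 = 0 := by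
    rw [← add_mul, h, zero_mul]
  rw [h1, h2, hT1, hT2] at h'
  simp only [rowSumN, List.map_cons, List.map_nil, List.sum_cons, List.sum_nil, CWeights.mono,
      pow_zero,
    pow_one, mul_one, one_mul, downCoeff, upCoeff, Matrix.cons_val_zero, Matrix.cons_val_one,
    Matrix.head_cons, Matrix.cons_val_two, Matrix.tail_cons, Matrix.cons_val_three, zero_mul,
    add_zero] at h'
  have key : plaqRow W t (dressDown W t c) .S * t ^ 2 = 0 := by
    rw [rowVS_mul ht]
    linear_combination h'
  exact (mul_eq_zero.1 key).resolve_right (pow_ne_zero 2 ht)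

/-- Instance on the bare vertical domino at the `W` side of `(0, 0)`: 4 + 4 walks. [cite: GlazmanManolescu2019, Lemma 2.1 (statement, "in the form given in [Gl]")] [cite: Glazman2015WeightedSAW, Lemma 3.1 (proof: the walks at one rhombus)] -/
private theorem instVW (hrel : ExactDominoVertexRelationV W t c) (ht : t ≠ 0) :
    plaqRow W t (dressDown W t c) .W = 0 := by
  have hT1 : termsN domV (Face.side (0, 0) .W) (0, 0) (depth domV) 2 =
      [⟨2, 0, 0, 0, 0, 0, 2⟩, ⟨0, 0, 0, 1, 0, 0, 2⟩, ⟨3, 0, 1, 0, 0, 0, 1⟩, ⟨1, 1, 0, 0, 0, 0,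
          3⟩] := by
    decide
  have hT2 : termsN domV (Face.side (0, 0) .W) (0, 1) (depth domV) 2 =
      [⟨3, 1, 0, 0, 0, 0, 3⟩, ⟨2, 1, 1, 0, 0, 0, 4⟩, ⟨0, 2, 0, 0, 0, 0, 2⟩, ⟨1, 1, 0, 1, 0, 0,
          3⟩] := by
    decide
  have h1 := vertexFunctional_mul_pow_eq_rowSumN W ht (downCoeff c (c 3)) domV (Face.side (0,
      0) .W) (0, 0) 2
    (by decide)
  have h2 := vertexFunctional_mul_pow_eq_rowSumN W ht (upCoeff c 0) domV (Face.side (0,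
      0) .W) (0, 1) 2
    (by decide)
  have h := split_domV hrel (a := Face.side (0, 0) .W) (by decide)
  have h' : vertexFunctional W t (downCoeff c (c 3)) domV (Face.side (0, 0) .W) (0, 0) * t ^ 2 +
      vertexFunctional W t (upCoeff c 0) domV (Face.side (0, 0) .W) (0, 1) * t ^ 2 = 0 := by
    rw [← add_mul, h, zero_mul]
  rw [h1, h2, hT1, hT2] at h'
  simp only [rowSumN, List.map_cons, List.map_nil, List.sum_cons, List.sum_nil, CWeights.mono,
      pow_zero,
    pow_one, mul_one, one_mul, downCoeff, upCoeff, Matrix.cons_val_zero, Matrix.cons_val_one,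
    Matrix.head_cons, Matrix.cons_val_two, Matrix.tail_cons, Matrix.cons_val_three, zero_mul,
    add_zero] at h'
  have key : plaqRow W t (dressDown W t c) .W * t ^ 2 = 0 := by
    rw [rowVW_mul ht]
    linear_combination h'
  exact (mul_eq_zero.1 key).resolve_right (pow_ne_zero 2 ht)

/-- Instance on the bare vertical domino at the `E` side of `(0, 0)`: 4 + 4 walks. [cite: GlazmanManolescu2019, Lemma 2.1 (statement, "in the form given in [Gl]")] [cite: Glazman2015WeightedSAW, Lemma 3.1 (proof: the walks at one rhombus)] -/
private theorem instVE (hrel : ExactDominoVertexRelationV W t c) (ht : t ≠ 0) :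
    plaqRow W t (dressDown W t c) .E = 0 := by
  have hT1 : termsN domV (Face.side (0, 0) .E) (0, 0) (depth domV) 2 =
      [⟨0, 0, 0, 0, 0, 0, 2⟩, ⟨2, 0, 0, 1, 0, 0, 2⟩, ⟨3, 1, 0, 0, 0, 0, 3⟩, ⟨1, 0, 1, 0, 0, 0,
          1⟩] := by
    decide
  have hT2 : termsN domV (Face.side (0, 0) .E) (0, 1) (depth domV) 2 =
      [⟨3, 0, 1, 0, 0, 0, 1⟩, ⟨2, 0, 2, 0, 0, 0, 2⟩, ⟨0, 1, 1, 0, 0, 0, 0⟩, ⟨1, 0, 1, 1, 0, 0,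
          1⟩] := by
    decide
  have h1 := vertexFunctional_mul_pow_eq_rowSumN W ht (downCoeff c (c 3)) domV (Face.side (0,
      0) .E) (0, 0) 2
    (by decide)
  have h2 := vertexFunctional_mul_pow_eq_rowSumN W ht (upCoeff c 0) domV (Face.side (0,
      0) .E) (0, 1) 2
    (by decide)
  have h := split_domV hrel (a := Face.side (0, 0) .E) (by decide)
  have h' : vertexFunctional W t (downCoeff c (c 3)) domV (Face.side (0, 0) .E) (0, 0) * t ^ 2 +
      vertexFunctional W t (upCoeff c 0) domV (Face.side (0, 0) .E) (0, 1) * t ^ 2 = 0 := by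
    rw [← add_mul, h, zero_mul]
  rw [h1, h2, hT1, hT2] at h'
  simp only [rowSumN, List.map_cons, List.map_nil, List.sum_cons, List.sum_nil, CWeights.mono,
      pow_zero,
    pow_one, mul_one, one_mul, downCoeff, upCoeff, Matrix.cons_val_zero, Matrix.cons_val_one,
    Matrix.head_cons, Matrix.cons_val_two, Matrix.tail_cons, Matrix.cons_val_three, zero_mul,
    add_zero] at h'
  have key : plaqRow W t (dressDown W t c) .E * t ^ 2 = 0 := by
    rw [rowVE_mul ht]
    linear_combination h'
  exact (mul_eq_zero.1 key).resolve_right (pow_ne_zero 2 ht)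

/-- Instance on the bare vertical domino at the `W` side of `(0, 1)`: 4 + 4 walks. [cite: GlazmanManolescu2019, Lemma 2.1 (statement, "in the form given in [Gl]")] [cite: Glazman2015WeightedSAW, Lemma 3.1 (proof: the walks at one rhombus)] -/
private theorem instUW (hrel : ExactDominoVertexRelationV W t c) (ht : t ≠ 0) :
    plaqRow W t (dressUp W t c) .W = 0 := by
  have hT1 : termsN domV (Face.side (0, 1) .W) (0, 0) (depth domV) 2 =
      [⟨1, 0, 1, 0, 0, 0, 1⟩, ⟨2, 1, 1, 0, 0, 0, 0⟩, ⟨0, 0, 2, 0, 0, 0, 2⟩, ⟨3, 0, 1, 1, 0, 0,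
          1⟩] := by
    decide
  have hT2 : termsN domV (Face.side (0, 1) .W) (0, 1) (depth domV) 2 =
      [⟨2, 0, 0, 0, 0, 0, 2⟩, ⟨0, 0, 0, 1, 0, 0, 2⟩, ⟨3, 0, 1, 0, 0, 0, 1⟩, ⟨1, 1, 0, 0, 0, 0,
          3⟩] := by
    decide
  have h1 := vertexFunctional_mul_pow_eq_rowSumN W ht (downCoeff c (c 3)) domV (Face.side (0,
      1) .W) (0, 0) 2
    (by decide)
  have h2 := vertexFunctional_mul_pow_eq_rowSumN W ht (upCoeff c 0) domV (Face.side (0,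
      1) .W) (0, 1) 2
    (by decide)
  have h := split_domV hrel (a := Face.side (0, 1) .W) (by decide)
  have h' : vertexFunctional W t (downCoeff c (c 3)) domV (Face.side (0, 1) .W) (0, 0) * t ^ 2 +
      vertexFunctional W t (upCoeff c 0) domV (Face.side (0, 1) .W) (0, 1) * t ^ 2 = 0 := by
    rw [← add_mul, h, zero_mul]
  rw [h1, h2, hT1, hT2] at h'
  simp only [rowSumN, List.map_cons, List.map_nil, List.sum_cons, List.sum_nil, CWeights.mono,
      pow_zero,
    pow_one, mul_one, one_mul, downCoeff, upCoeff, Matrix.cons_val_zero, Matrix.cons_val_one,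
    Matrix.head_cons, Matrix.cons_val_two, Matrix.tail_cons, Matrix.cons_val_three, zero_mul,
    add_zero] at h'
  have key : plaqRow W t (dressUp W t c) .W * t ^ 2 = 0 := by
    rw [rowUW_mul ht]
    linear_combination h'
  exact (mul_eq_zero.1 key).resolve_right (pow_ne_zero 2 ht)

/-- Instance on the bare vertical domino at the `E` side of `(0, 1)`: 4 + 4 walks. [cite: GlazmanManolescu2019, Lemma 2.1 (statement, "in the form given in [Gl]")] [cite: Glazman2015WeightedSAW, Lemma 3.1 (proof: the walks at one rhombus)] -/
private theorem instUE (hrel : ExactDominoVertexRelationV W t c) (ht : t ≠ 0) :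
    plaqRow W t (dressUp W t c) .E = 0 := by
  have hT1 : termsN domV (Face.side (0, 1) .E) (0, 0) (depth domV) 2 =
      [⟨1, 1, 0, 0, 0, 0, 3⟩, ⟨2, 2, 0, 0, 0, 0, 2⟩, ⟨0, 1, 1, 0, 0, 0, 4⟩, ⟨3, 1, 0, 1, 0, 0,
          3⟩] := by
    decide
  have hT2 : termsN domV (Face.side (0, 1) .E) (0, 1) (depth domV) 2 =
      [⟨0, 0, 0, 0, 0, 0, 2⟩, ⟨2, 0, 0, 1, 0, 0, 2⟩, ⟨3, 1, 0, 0, 0, 0, 3⟩, ⟨1, 0, 1, 0, 0, 0,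
          1⟩] := by
    decide
  have h1 := vertexFunctional_mul_pow_eq_rowSumN W ht (downCoeff c (c 3)) domV (Face.side (0,
      1) .E) (0, 0) 2
    (by decide)
  have h2 := vertexFunctional_mul_pow_eq_rowSumN W ht (upCoeff c 0) domV (Face.side (0,
      1) .E) (0, 1) 2
    (by decide)
  have h := split_domV hrel (a := Face.side (0, 1) .E) (by decide)
  have h' : vertexFunctional W t (downCoeff c (c 3)) domV (Face.side (0, 1) .E) (0, 0) * t ^ 2 +
      vertexFunctional W t (upCoeff c 0) domV (Face.side (0, 1) .E) (0, 1) * t ^ 2 = 0 := by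
    rw [← add_mul, h, zero_mul]
  rw [h1, h2, hT1, hT2] at h'
  simp only [rowSumN, List.map_cons, List.map_nil, List.sum_cons, List.sum_nil, CWeights.mono,
      pow_zero,
    pow_one, mul_one, one_mul, downCoeff, upCoeff, Matrix.cons_val_zero, Matrix.cons_val_one,
    Matrix.head_cons, Matrix.cons_val_two, Matrix.tail_cons, Matrix.cons_val_three, zero_mul,
    add_zero] at h'
  have key : plaqRow W t (dressUp W t c) .E * t ^ 2 = 0 := by
    rw [rowUE_mul ht]
    linear_combination h'
  exact (mul_eq_zero.1 key).resolve_right (pow_ne_zero 2 ht)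

/-- Instance on the bare vertical domino at the `N` side of `(0, 1)`: 4 + 4 walks. [cite: GlazmanManolescu2019, Lemma 2.1 (statement, "in the form given in [Gl]")] [cite: Glazman2015WeightedSAW, Lemma 3.1 (proof: the walks at one rhombus)] -/
private theorem instUN (hrel : ExactDominoVertexRelationV W t c) (ht : t ≠ 0) :
    plaqRow W t (dressUp W t c) .N = 0 := by
  have hT1 : termsN domV (Face.side (0, 1) .N) (0, 0) (depth domV) 2 =
      [⟨1, 0, 0, 1, 0, 0, 2⟩, ⟨2, 1, 0, 1, 0, 0, 1⟩, ⟨0, 0, 1, 1, 0, 0, 3⟩, ⟨3, 0, 0, 2, 0, 0,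
          2⟩] := by
    decide
  have hT2 : termsN domV (Face.side (0, 1) .N) (0, 1) (depth domV) 2 =
      [⟨1, 0, 0, 0, 0, 0, 2⟩, ⟨2, 1, 0, 0, 0, 0, 1⟩, ⟨0, 0, 1, 0, 0, 0, 3⟩, ⟨3, 0, 0, 1, 0, 0,
          2⟩] := by
    decide
  have h1 := vertexFunctional_mul_pow_eq_rowSumN W ht (downCoeff c (c 3)) domV (Face.side (0,
      1) .N) (0, 0) 2
    (by decide)
  have h2 := vertexFunctional_mul_pow_eq_rowSumN W ht (upCoeff c 0) domV (Face.side (0,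
      1) .N) (0, 1) 2
    (by decide)
  have h := split_domV hrel (a := Face.side (0, 1) .N) (by decide)
  have h' : vertexFunctional W t (downCoeff c (c 3)) domV (Face.side (0, 1) .N) (0, 0) * t ^ 2 +
      vertexFunctional W t (upCoeff c 0) domV (Face.side (0, 1) .N) (0, 1) * t ^ 2 = 0 := by
    rw [← add_mul, h, zero_mul]
  rw [h1, h2, hT1, hT2] at h'
  simp only [rowSumN, List.map_cons, List.map_nil, List.sum_cons, List.sum_nil, CWeights.mono,
      pow_zero,
    pow_one, mul_one, one_mul, downCoeff, upCoeff, Matrix.cons_val_zero, Matrix.cons_val_one,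
    Matrix.head_cons, Matrix.cons_val_two, Matrix.tail_cons, Matrix.cons_val_three, zero_mul,
    add_zero] at h'
  have key : plaqRow W t (dressUp W t c) .N * t ^ 2 = 0 := by
    rw [rowUN_mul ht]
    linear_combination h'
  exact (mul_eq_zero.1 key).resolve_right (pow_ne_zero 2 ht)

/-- ★ **NECESSITY of the six vertical rows, for EVERY weight system**: an exact vertical domino relation at
phase `t ≠ 0` forces `DominoRowsV`. [cite: Glazman2015WeightedSAW, Lemma 3.1 (proof: necessity of the one-rhombus linear system)] -/
theorem dominoRowsV_of_exactDominoVertexRelationV (hrel : ExactDominoVertexRelationV W t c) (ht : t ≠ 0) :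
    DominoRowsV W t c :=
  ⟨instVS hrel ht, instVW hrel ht, instVE hrel ht, instUW hrel ht, instUE hrel ht, instUN hrel ht⟩

end NecessityV

/-! ## Generic triviality (vertical) -/

section GenericV

variable {W : CWeights} {t : ℂ} {c : Fin 7 → ℂ}

/-- ★ **The vertical antisymmetric determinant** — literally the horizontal polynomial `dominoDetA`
(`dominoDetAV_eq_dominoDetA`). [cite: Glazman2015WeightedSAW, Lemma 3.1 (proof: the determinant of the one-rhombus linear system)] -/
def dominoDetAV (W : CWeights) (t : ℂ) : ℂ :=
  t ^ 4 - 2 * W.v ^ 2 * t ^ 4 + W.v ^ 4 * t ^ 4 - 2 * W.u₂ ^ 2 * t ^ 4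
      - 2 * W.u₂ ^ 2 * W.v ^ 2 * t ^ 4 + W.u₂ ^ 4 * t ^ 4 + 4 * W.u₁ * W.u₂ * W.v * t ^ 2
      + 4 * W.u₁ * W.u₂ * W.v * t ^ 6 - 2 * W.u₁ ^ 2 * t ^ 4 - 2 * W.u₁ ^ 2 * W.v ^ 2 * t ^ 4
      - (W.u₁ ^ 2 * W.u₂ ^ 2) - (W.u₁ ^ 2 * W.u₂ ^ 2 * t ^ 8) + W.u₁ ^ 4 * t ^ 4

/-- `dominoDetAV = dominoDetA`. [cite: Glazman2015WeightedSAW, Lemma 3.1 (proof: the determinant of the one-rhombus linear system)] -/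
theorem dominoDetAV_eq_dominoDetA (W : CWeights) (t : ℂ) : dominoDetAV W t = dominoDetA W t := by
  rw [dominoDetAV, dominoDetA]

/-- ★ **The vertical symmetric determinant** (three symmetrised cleared vertical rows and the symmetrised
`2 × 2`-block instance, divided by `2u₁²u₂t⁵`): 21 terms. [cite: Glazman2015WeightedSAW, Lemma 3.1 (proof: the determinant of the one-rhombus linear system)] -/
def dominoDetSV (W : CWeights) (t : ℂ) : ℂ :=
  -(W.u₂ * W.v) + 2 * W.u₂ * W.v * W.w₁ * t ^ 4 - (W.u₂ * W.v ^ 3) + W.u₂ ^ 3 * W.v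
      - (W.u₁ * W.w₁ * t ^ 6) + 2 * W.u₁ * W.v ^ 2 * t ^ 2 + W.u₁ * W.v ^ 2 * t ^ 6
      - (W.u₁ * W.v ^ 2 * W.w₁ * t ^ 6) - (W.u₁ * W.v ^ 4 * t ^ 6) + W.u₁ * W.u₂ ^ 2 * t ^ 6
      - (W.u₁ * W.u₂ ^ 2 * W.w₁ * t ^ 2) + 2 * W.u₁ * W.u₂ ^ 2 * W.v ^ 2 * t ^ 6
      - (W.u₁ * W.u₂ ^ 4 * t ^ 6) - 4 * W.u₁ ^ 2 * W.u₂ * W.v * t ^ 4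
      - 3 * W.u₁ ^ 2 * W.u₂ * W.v * t ^ 8 + W.u₁ ^ 3 * t ^ 6 + W.u₁ ^ 3 * W.w₁ * t ^ 6
      + 2 * W.u₁ ^ 3 * W.v ^ 2 * t ^ 6 + W.u₁ ^ 3 * W.u₂ ^ 2 * t ^ 2
      + W.u₁ ^ 3 * W.u₂ ^ 2 * t ^ 10 - (W.u₁ ^ 5 * t ^ 6)

/-- `dominoDetSV` of the uniform self-avoiding walk `(x, x, x, 0, 0)`. [cite: GlazmanManolescu2019, §1 (the uniform walk as a point of the family)] -/
theorem dominoDetSV_saw (x t : ℂ) : dominoDetSV ⟨x, x, x, 0, 0⟩ t = -(x ^ 2)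
    + 2 * x ^ 3 * t ^ 2 + 3 * x ^ 3 * t ^ 6 - 4 * x ^ 4 * t ^ 4 - 3 * x ^ 4 * t ^ 8
    + x ^ 5 * t ^ 2 + x ^ 5 * t ^ 6 + x ^ 5 * t ^ 10 := by
  rw [dominoDetSV]; ring

/-- The upper-right `2 × 2` block over the vertical domino. [cite: GlazmanManolescu2019, §1 (faces (k, j))] -/
def blkV : List Face := [(0, 0), (0, 1), (1, 0), (1, 1)]

/-- Its half-turn image about the centre of the vertical domino. [cite: GlazmanManolescu2019, §1 (faces (k, j))] -/
def blkV' : List Face := [(0, 1), (0, 0), (-1, 1), (-1, 0)]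

/-- The relation on `blkV`, split. [cite: DuminilCopinSmirnov2012, Lemma 1 (linear in the coefficients)] -/
private theorem split_blkV (hrel : ExactDominoVertexRelationV W t c) {a : MidEdge}
    (ha : IsBoundaryRoot blkV a) :
    vertexFunctional W t (downCoeff c (c 3)) blkV a (0, 0) +
      vertexFunctional W t (upCoeff c 0) blkV a (0, 1) = 0 := by
  have h := hrel blkV a (0, 0) (by simp [blkV]) (by simp [blkV, north]) ha
  rwa [dominoFunctionalV_eq_add W t c blkV a (0, 0) (show c 3 + 0 = c 3 by ring)] at h

/-- The relation on `blkV'`, split. [cite: DuminilCopinSmirnov2012, Lemma 1 (linear in the coefficients)] -/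
private theorem split_blkV' (hrel : ExactDominoVertexRelationV W t c) {a : MidEdge}
    (ha : IsBoundaryRoot blkV' a) :
    vertexFunctional W t (downCoeff c (c 3)) blkV' a (0, 0) +
      vertexFunctional W t (upCoeff c 0) blkV' a (0, 1) = 0 := by
  have h := hrel blkV' a (0, 0) (by simp [blkV']) (by simp [blkV', north]) ha
  rwa [dominoFunctionalV_eq_add W t c blkV' a (0, 0) (show c 3 + 0 = c 3 by ring)] at h

/-- ★ Instance on `blkV` from the SOUTH side of `(0,0)` (7 + 8 walks, cleared by `t³`), incl. the walk doubling the corner plaquette (weight `w₁`). [cite: GlazmanManolescu2019, Lemma 2.1 (statement, "in the form given in [Gl]")] [cite: Glazman2015WeightedSAW, Lemma 3.1 (proof: the walks at one rhombus)] -/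
private theorem instBlockVS (hrel : ExactDominoVertexRelationV W t c) (ht : t ≠ 0) :
    c 0 * t ^ 3 + c 1 * W.u₂ * t ^ 4 + c 3 * W.v * t ^ 3 + c 2 * W.u₁ ^ 2 * W.u₂ * W.v
        + c 2 * W.u₁ * t ^ 2 + c 3 * W.u₁ ^ 3 * W.u₂ * t ^ 5
        + c 1 * W.u₁ ^ 2 * W.u₂ * W.w₁ * t ^ 4 + c 4 * W.u₂ * W.v * t ^ 4
        + c 6 * W.v ^ 2 * t ^ 3 + c 5 * W.u₁ * W.v * t ^ 2 + c 5 * W.u₁ ^ 2 * W.u₂ * t ^ 4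
        + c 4 * W.u₁ ^ 2 * W.u₂ * W.v * t ^ 4 + c 6 * W.u₁ ^ 2 * W.u₂ ^ 2 * t ^ 3 = 0 := by
  have hT1 : termsN blkV (Face.side (0, 0) .S) (0, 0) (depth blkV) 3 =
      [⟨3, 0, 0, 0, 0, 0, 3⟩, ⟨2, 0, 1, 0, 0, 0, 4⟩, ⟨1, 0, 0, 1, 0, 0, 3⟩, ⟨0, 2, 1, 1, 0, 0,
          0⟩, ⟨0, 1, 0, 0, 0, 0, 2⟩, ⟨1, 3, 1, 0, 0, 0, 5⟩, ⟨2, 2, 1, 0, 1, 0, 4⟩] := by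
    decide
  have hT2 : termsN blkV (Face.side (0, 0) .S) (0, 1) (depth blkV) 3 =
      [⟨3, 0, 0, 1, 0, 0, 3⟩, ⟨2, 0, 1, 1, 0, 0, 4⟩, ⟨1, 0, 0, 2, 0, 0, 3⟩, ⟨0, 1, 0, 1, 0, 0,
          2⟩, ⟨0, 2, 1, 0, 0, 0, 4⟩, ⟨2, 2, 1, 1, 0, 0, 4⟩, ⟨3, 3, 1, 0, 0, 0, 5⟩, ⟨1, 2, 2, 0,
          0, 0, 3⟩] := by
    decide
  have h1 := vertexFunctional_mul_pow_eq_rowSumN W ht (downCoeff c (c 3)) blkV (Face.side (0,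
      0) .S) (0, 0) 3
    (by decide)
  have h2 := vertexFunctional_mul_pow_eq_rowSumN W ht (upCoeff c 0) blkV (Face.side (0,
      0) .S) (0, 1) 3
    (by decide)
  have h := split_blkV hrel (a := Face.side (0, 0) .S) (by decide)
  have h' : vertexFunctional W t (downCoeff c (c 3)) blkV (Face.side (0, 0) .S) (0, 0) * t ^ 3 +
      vertexFunctional W t (upCoeff c 0) blkV (Face.side (0, 0) .S) (0, 1) * t ^ 3 = 0 := by
    rw [← add_mul, h, zero_mul]
  rw [h1, h2, hT1, hT2] at h'
  simp only [rowSumN, List.map_cons, List.map_nil, List.sum_cons, List.sum_nil, CWeights.mono,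
      pow_zero,
    pow_one, mul_one, one_mul, downCoeff, upCoeff, Matrix.cons_val_zero, Matrix.cons_val_one,
    Matrix.head_cons, Matrix.cons_val_two, Matrix.tail_cons, Matrix.cons_val_three, zero_mul,
    add_zero] at h'
  linear_combination h'

/-- ★ The half-turn image: instance on `blkV'` from the NORTH side of `(0,1)`. [cite: GlazmanManolescu2019, Lemma 2.1 (statement, "in the form given in [Gl]")] [cite: Glazman2015WeightedSAW, Lemma 3.1 (proof: the walks at one rhombus)] -/
private theorem instBlockVN (hrel : ExactDominoVertexRelationV W t c) (ht : t ≠ 0) :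
    c 3 * W.v * t ^ 3 + c 2 * W.u₂ * W.v * t ^ 4 + c 0 * W.v ^ 2 * t ^ 3
        + c 1 * W.u₁ * W.v * t ^ 2 + c 1 * W.u₁ ^ 2 * W.u₂ * t ^ 4
        + c 2 * W.u₁ ^ 2 * W.u₂ * W.v * t ^ 4 + c 0 * W.u₁ ^ 2 * W.u₂ ^ 2 * t ^ 3
        + c 3 * W.u₁ ^ 3 * W.u₂ * t ^ 5 + c 6 * t ^ 3 + c 5 * W.u₂ * t ^ 4
        + c 4 * W.u₁ ^ 2 * W.u₂ * W.v + c 4 * W.u₁ * t ^ 2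
        + c 5 * W.u₁ ^ 2 * W.u₂ * W.w₁ * t ^ 4 = 0 := by
  have hT1 : termsN blkV' (Face.side (0, 1) .N) (0, 0) (depth blkV') 3 =
      [⟨1, 0, 0, 1, 0, 0, 3⟩, ⟨0, 0, 1, 1, 0, 0, 4⟩, ⟨3, 0, 0, 2, 0, 0, 3⟩, ⟨2, 1, 0, 1, 0, 0,
          2⟩, ⟨2, 2, 1, 0, 0, 0, 4⟩, ⟨0, 2, 1, 1, 0, 0, 4⟩, ⟨3, 2, 2, 0, 0, 0, 3⟩, ⟨1, 3, 1, 0,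
          0, 0, 5⟩] := by
    decide
  have hT2 : termsN blkV' (Face.side (0, 1) .N) (0, 1) (depth blkV') 3 =
      [⟨1, 0, 0, 0, 0, 0, 3⟩, ⟨0, 0, 1, 0, 0, 0, 4⟩, ⟨3, 0, 0, 1, 0, 0, 3⟩, ⟨2, 2, 1, 1, 0, 0,
          0⟩, ⟨2, 1, 0, 0, 0, 0, 2⟩, ⟨3, 3, 1, 0, 0, 0, 5⟩, ⟨0, 2, 1, 0, 1, 0, 4⟩] := by
    decide
  have h1 := vertexFunctional_mul_pow_eq_rowSumN W ht (downCoeff c (c 3)) blkV' (Face.side (0,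
      1) .N) (0, 0) 3
    (by decide)
  have h2 := vertexFunctional_mul_pow_eq_rowSumN W ht (upCoeff c 0) blkV' (Face.side (0,
      1) .N) (0, 1) 3
    (by decide)
  have h := split_blkV' hrel (a := Face.side (0, 1) .N) (by decide)
  have h' : vertexFunctional W t (downCoeff c (c 3)) blkV' (Face.side (0, 1) .N) (0, 0) * t ^ 3 +
      vertexFunctional W t (upCoeff c 0) blkV' (Face.side (0, 1) .N) (0, 1) * t ^ 3 = 0 := by
    rw [← add_mul, h, zero_mul]
  rw [h1, h2, hT1, hT2] at h'
  simp only [rowSumN, List.map_cons, List.map_nil, List.sum_cons, List.sum_nil, CWeights.mono,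
      pow_zero,
    pow_one, mul_one, one_mul, downCoeff, upCoeff, Matrix.cons_val_zero, Matrix.cons_val_one,
    Matrix.head_cons, Matrix.cons_val_two, Matrix.tail_cons, Matrix.cons_val_three, zero_mul,
    add_zero] at h'
  linear_combination h'

/-- ★★ **Generic triviality of the vertical domino class**: for `u₁u₂ ≠ 0`, `t ≠ 0`, if `dominoDetAV W t ≠ 0`
and `dominoDetSV W t ≠ 0` then every exact vertical domino relation is trivial (adjugate certificates by
`ring`). [cite: Glazman2015WeightedSAW, Lemma 3.1 (proof: "solving this linear system")] [cite: IkhlefCardy2009, §3 (determinant of the local linear system)] -/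
theorem eq_zero_of_exactDominoVertexRelationV (ht : t ≠ 0) (h1 : W.u₁ ≠ 0) (h2 : W.u₂ ≠ 0)
    (hA : dominoDetAV W t ≠ 0) (hS : dominoDetSV W t ≠ 0) (hrel : ExactDominoVertexRelationV W t c) :
    c = 0 := by
  obtain ⟨rS, rW, rE, rW', rE', rN'⟩ := dominoRowsV_of_exactDominoVertexRelationV hrel ht
  have eVS : c 0 * t ^ 2 + c 1 * W.u₂ * t ^ 3 + c 2 * W.u₁ * t + c 3 * W.v * t ^ 2
      + c 4 * W.u₂ * W.v * t ^ 3 + c 5 * W.u₁ * W.v * t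
      + c 6 * W.v ^ 2 * t ^ 2 = 0 := by rw [← rowVS_mul (W := W) (c := c) ht, rS, zero_mul]
  have eVW : c 0 * W.u₂ * t + c 1 * t ^ 2 + c 2 * W.v * t ^ 2 + c 3 * W.u₁ * t ^ 3
      + c 4 * W.u₁ * W.u₂ * t ^ 4 + c 5 * W.u₁ ^ 2 * t ^ 2
      + c 6 * W.u₁ * W.v * t ^ 3 = 0 := by rw [← rowVW_mul (W := W) (c := c) ht, rW, zero_mul]
  have eVE : c 0 * W.u₁ * t ^ 3 + c 1 * W.v * t ^ 2 + c 2 * t ^ 2 + c 3 * W.u₂ * t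
      + c 4 * W.u₂ ^ 2 * t ^ 2 + c 5 * W.u₁ * W.u₂
      + c 6 * W.u₂ * W.v * t = 0 := by rw [← rowVE_mul (W := W) (c := c) ht, rE, zero_mul]
  have eUW : c 0 * W.u₂ * W.v * t + c 1 * W.u₁ * W.u₂ + c 2 * W.u₂ ^ 2 * t ^ 2 + c 3 * W.u₂ * t
      + c 4 * t ^ 2 + c 5 * W.v * t ^ 2
      + c 6 * W.u₁ * t ^ 3 = 0 := by rw [← rowUW_mul (W := W) (c := c) ht, rW', zero_mul]
  have eUE : c 0 * W.u₁ * W.v * t ^ 3 + c 1 * W.u₁ ^ 2 * t ^ 2 + c 2 * W.u₁ * W.u₂ * t ^ 4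
      + c 3 * W.u₁ * t ^ 3 + c 4 * W.v * t ^ 2 + c 5 * t ^ 2
      + c 6 * W.u₂ * t = 0 := by rw [← rowUE_mul (W := W) (c := c) ht, rE', zero_mul]
  have eUN : c 0 * W.v ^ 2 * t ^ 2 + c 1 * W.u₁ * W.v * t + c 2 * W.u₂ * W.v * t ^ 3
      + c 3 * W.v * t ^ 2 + c 4 * W.u₁ * t + c 5 * W.u₂ * t ^ 3
      + c 6 * t ^ 2 = 0 := by rw [← rowUN_mul (W := W) (c := c) ht, rN', zero_mul]
  have b1 := instBlockVS hrel ht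
  have b2 := instBlockVN hrel ht
  have ka0 : t ^ 2 * dominoDetAV W t * (c 0 - c 6) = 0 := by
    rw [dominoDetAV]
    linear_combination (t ^ 4 - (W.v ^ 2 * t ^ 4) - (W.u₂ ^ 2 * t ^ 4)
        + W.u₁ * W.u₂ * W.v * t ^ 2 + W.u₁ * W.u₂ * W.v * t ^ 6 - (W.u₁ ^ 2 * t ^ 4)) * (eVS
        - eUN) + (-(W.u₂ * t ^ 5) - (W.u₂ * W.v ^ 2 * t ^ 5) + W.u₂ ^ 3 * t ^ 5
        + 2 * W.u₁ * W.v * t ^ 3 - (W.u₁ ^ 2 * W.u₂ * t)) * (eVW - eUE) +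
      (2 * W.u₂ * W.v * t ^ 5 - (W.u₁ * t ^ 3) - (W.u₁ * W.v ^ 2 * t ^ 3)
          - (W.u₁ * W.u₂ ^ 2 * t ^ 7) + W.u₁ ^ 3 * t ^ 3) * (eVE - eUW)
  have ka1 : t ^ 2 * dominoDetAV W t * (c 1 - c 5) = 0 := by
    rw [dominoDetAV]
    linear_combination (-(W.u₂ * t ^ 3) - (W.u₂ * W.v ^ 2 * t ^ 3) + W.u₂ ^ 3 * t ^ 3
        + 2 * W.u₁ * W.v * t ^ 5 - (W.u₁ ^ 2 * W.u₂ * t ^ 7)) * (eVS - eUN) + (t ^ 4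
        - (W.v ^ 2 * t ^ 4) - (W.u₂ ^ 2 * t ^ 4) + W.u₁ * W.u₂ * W.v * t ^ 2
        + W.u₁ * W.u₂ * W.v * t ^ 6 - (W.u₁ ^ 2 * t ^ 4)) * (eVW - eUE) +
      (-(W.v * t ^ 4) + W.v ^ 3 * t ^ 4 - (W.u₂ ^ 2 * W.v * t ^ 4) + W.u₁ * W.u₂ * t ^ 2
          + W.u₁ * W.u₂ * t ^ 6 - (W.u₁ ^ 2 * W.v * t ^ 4)) * (eVE - eUW)
  have ka2 : t ^ 2 * dominoDetAV W t * (c 2 - c 4) = 0 := by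
    rw [dominoDetAV]
    linear_combination (2 * W.u₂ * W.v * t ^ 3 - (W.u₁ * t ^ 5) - (W.u₁ * W.v ^ 2 * t ^ 5)
        - (W.u₁ * W.u₂ ^ 2 * t) + W.u₁ ^ 3 * t ^ 5) * (eVS - eUN) + (-(W.v * t ^ 4)
        + W.v ^ 3 * t ^ 4 - (W.u₂ ^ 2 * W.v * t ^ 4) + W.u₁ * W.u₂ * t ^ 2
        + W.u₁ * W.u₂ * t ^ 6 - (W.u₁ ^ 2 * W.v * t ^ 4)) * (eVW - eUE) +
      (t ^ 4 - (W.v ^ 2 * t ^ 4) - (W.u₂ ^ 2 * t ^ 4) + W.u₁ * W.u₂ * W.v * t ^ 2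
          + W.u₁ * W.u₂ * W.v * t ^ 6 - (W.u₁ ^ 2 * t ^ 4)) * (eVE - eUW)
  have ks0 : 2 * W.u₁ ^ 2 * W.u₂ * t ^ 5 * dominoDetSV W t * (c 0 + c 6) = 0 := by
    rw [dominoDetSV]
    linear_combination (2 * W.v * t ^ 7 - 2 * W.v ^ 3 * t ^ 7 + 2 * W.u₂ ^ 2 * W.v * t ^ 7
        - 2 * W.u₁ * W.u₂ * t ^ 5 - 2 * W.u₁ * W.u₂ * t ^ 9 + 2 * W.u₁ ^ 2 * W.v * t ^ 7
        - 2 * W.u₁ ^ 2 * W.u₂ ^ 2 * W.v * t ^ 3 + 2 * W.u₁ ^ 2 * W.u₂ ^ 2 * W.v * W.w₁ * t ^ 7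
        - 2 * W.u₁ ^ 3 * W.u₂ * W.w₁ * t ^ 9 + 2 * W.u₁ ^ 3 * W.u₂ * W.v ^ 2 * t ^ 5
        + 2 * W.u₁ ^ 3 * W.u₂ ^ 3 * t ^ 9 - 2 * W.u₁ ^ 4 * W.u₂ ^ 2 * W.v * t ^ 7
        - 2 * W.u₁ ^ 4 * W.u₂ ^ 2 * W.v * t ^ 11 + 2 * W.u₁ ^ 5 * W.u₂ * t ^ 9) * (eVS + eUN)
        + (2 * W.u₁ ^ 2 * W.u₂ * W.v * t ^ 8 + 2 * W.u₁ ^ 2 * W.u₂ * W.v * W.w₁ * t ^ 8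
        - 2 * W.u₁ ^ 2 * W.u₂ * W.v ^ 3 * t ^ 4 - 2 * W.u₁ ^ 2 * W.u₂ * W.v ^ 3 * t ^ 8
        + 2 * W.u₁ ^ 2 * W.u₂ ^ 3 * W.v * t ^ 4 + 2 * W.u₁ ^ 2 * W.u₂ ^ 3 * W.v * t ^ 8
        - 2 * W.u₁ ^ 3 * W.u₂ ^ 2 * t ^ 6 - 2 * W.u₁ ^ 3 * W.u₂ ^ 2 * t ^ 10
        - 2 * W.u₁ ^ 3 * W.u₂ ^ 2 * W.w₁ * t ^ 6 + 2 * W.u₁ ^ 3 * W.u₂ ^ 2 * W.v ^ 2 * t ^ 10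
        - 2 * W.u₁ ^ 3 * W.u₂ ^ 4 * t ^ 10 + 2 * W.u₁ ^ 5 * W.u₂ ^ 2 * t ^ 6) * (eVW + eUE) +
      (2 * W.u₁ ^ 2 * W.u₂ * W.v ^ 2 * t ^ 4 - 2 * W.u₁ ^ 2 * W.u₂ * W.v ^ 2 * W.w₁ * t ^ 8
          - 2 * W.u₁ ^ 3 * W.u₂ ^ 2 * W.v * t ^ 6 - 2 * W.u₁ ^ 3 * W.u₂ ^ 2 * W.v * t ^ 10
          + 2 * W.u₁ ^ 4 * W.u₂ * W.w₁ * t ^ 8 + 2 * W.u₁ ^ 4 * W.u₂ * W.v ^ 2 * t ^ 8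
          + 2 * W.u₁ ^ 4 * W.u₂ ^ 3 * t ^ 12 - 2 * W.u₁ ^ 6 * W.u₂ * t ^ 8) * (eVE + eUW)
          + (-2 * W.v * t ^ 6 + 2 * W.v ^ 3 * t ^ 6 - 2 * W.u₂ ^ 2 * W.v * t ^ 6
          + 2 * W.u₁ * W.u₂ * t ^ 4 + 2 * W.u₁ * W.u₂ * t ^ 8
          - 2 * W.u₁ ^ 2 * W.v * t ^ 6) * (b1 + b2)
  have ks1 : 2 * W.u₁ ^ 2 * W.u₂ * t ^ 5 * dominoDetSV W t * (c 1 + c 5) = 0 := by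
    rw [dominoDetSV]
    linear_combination (-4 * W.u₂ * W.v * t ^ 6 + 2 * W.u₁ * t ^ 8 + 2 * W.u₁ * W.v ^ 2 * t ^ 8
        + 2 * W.u₁ * W.u₂ ^ 2 * t ^ 4 + 2 * W.u₁ ^ 2 * W.u₂ ^ 3 * W.v * t ^ 2
        - 2 * W.u₁ ^ 3 * t ^ 8 + 2 * W.u₁ ^ 3 * W.u₂ ^ 2 * W.v ^ 2 * t ^ 8
        - 2 * W.u₁ ^ 3 * W.u₂ ^ 4 * t ^ 8 - 2 * W.u₁ ^ 4 * W.u₂ * W.v * t ^ 6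
        - 2 * W.u₁ ^ 4 * W.u₂ * W.v * t ^ 10 + 2 * W.u₁ ^ 5 * W.u₂ ^ 2 * t ^ 12) * (eVS + eUN)
        + (-2 * W.u₁ ^ 2 * W.u₂ ^ 2 * W.v * t ^ 3 - 4 * W.u₁ ^ 2 * W.u₂ ^ 2 * W.v * t ^ 7
        + 2 * W.u₁ ^ 3 * W.u₂ * t ^ 9 + 2 * W.u₁ ^ 3 * W.u₂ * W.v ^ 2 * t ^ 5
        + 4 * W.u₁ ^ 3 * W.u₂ * W.v ^ 2 * t ^ 9 + 2 * W.u₁ ^ 3 * W.u₂ ^ 3 * t ^ 5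
        + 2 * W.u₁ ^ 3 * W.u₂ ^ 3 * t ^ 9 - 2 * W.u₁ ^ 4 * W.u₂ ^ 2 * W.v * t ^ 7
        - 2 * W.u₁ ^ 4 * W.u₂ ^ 2 * W.v * t ^ 11 - 2 * W.u₁ ^ 5 * W.u₂ * t ^ 9) * (eVW + eUE) +
      (-2 * W.u₁ ^ 2 * W.u₂ ^ 2 * W.v ^ 2 * t ^ 3 + 2 * W.u₁ ^ 3 * W.u₂ * W.v * t ^ 5
          - 2 * W.u₁ ^ 3 * W.u₂ * W.v ^ 3 * t ^ 9 + 2 * W.u₁ ^ 3 * W.u₂ ^ 3 * W.v * t ^ 9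
          - 2 * W.u₁ ^ 4 * W.u₂ ^ 2 * t ^ 11 + 2 * W.u₁ ^ 5 * W.u₂ * W.v * t ^ 9) * (eVE + eUW)
          + (4 * W.u₂ * W.v * t ^ 5 - 2 * W.u₁ * t ^ 7 - 2 * W.u₁ * W.v ^ 2 * t ^ 7
          - 2 * W.u₁ * W.u₂ ^ 2 * t ^ 3 + 2 * W.u₁ ^ 3 * t ^ 7) * (b1 + b2)
  have ks2 : 2 * W.u₁ ^ 2 * W.u₂ * t ^ 5 * dominoDetSV W t * (c 2 + c 4) = 0 := by
    rw [dominoDetSV]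
    linear_combination (2 * W.u₂ * t ^ 6 + 2 * W.u₂ * W.v ^ 2 * t ^ 6 - 2 * W.u₂ ^ 3 * t ^ 6
        - 4 * W.u₁ * W.v * t ^ 8 + 2 * W.u₁ ^ 2 * W.u₂ * t ^ 10
        - 2 * W.u₁ ^ 2 * W.u₂ ^ 3 * W.w₁ * t ^ 6 - 2 * W.u₁ ^ 3 * W.u₂ ^ 2 * W.v * t ^ 8
        + 2 * W.u₁ ^ 4 * W.u₂ * W.w₁ * t ^ 10 + 2 * W.u₁ ^ 4 * W.u₂ * W.v ^ 2 * t ^ 10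
        + 2 * W.u₁ ^ 4 * W.u₂ ^ 3 * t ^ 6 - 2 * W.u₁ ^ 6 * W.u₂ * t ^ 10) * (eVS + eUN)
        + (2 * W.u₁ ^ 2 * W.u₂ ^ 2 * t ^ 7 + 2 * W.u₁ ^ 2 * W.u₂ ^ 2 * W.w₁ * t ^ 7
        + 2 * W.u₁ ^ 2 * W.u₂ ^ 2 * W.v ^ 2 * t ^ 7 - 2 * W.u₁ ^ 2 * W.u₂ ^ 4 * t ^ 7
        - 4 * W.u₁ ^ 3 * W.u₂ * W.v * t ^ 9 - 2 * W.u₁ ^ 3 * W.u₂ * W.v * W.w₁ * t ^ 9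
        - 2 * W.u₁ ^ 3 * W.u₂ * W.v ^ 3 * t ^ 9 + 2 * W.u₁ ^ 3 * W.u₂ ^ 3 * W.v * t ^ 9
        - 2 * W.u₁ ^ 4 * W.u₂ ^ 2 * t ^ 7 + 2 * W.u₁ ^ 4 * W.u₂ ^ 2 * t ^ 11
        + 2 * W.u₁ ^ 5 * W.u₂ * W.v * t ^ 9) * (eVW + eUE) +
      (2 * W.u₁ ^ 2 * W.u₂ ^ 2 * W.v * W.w₁ * t ^ 7 - 2 * W.u₁ ^ 3 * W.u₂ * W.w₁ * t ^ 9
          + 2 * W.u₁ ^ 3 * W.u₂ * W.v ^ 2 * t ^ 9 - 2 * W.u₁ ^ 4 * W.u₂ ^ 2 * W.v * t ^ 7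
          - 2 * W.u₁ ^ 4 * W.u₂ ^ 2 * W.v * t ^ 11 + 2 * W.u₁ ^ 5 * W.u₂ * t ^ 9) * (eVE + eUW)
          + (-2 * W.u₂ * t ^ 5 - 2 * W.u₂ * W.v ^ 2 * t ^ 5 + 2 * W.u₂ ^ 3 * t ^ 5
          + 4 * W.u₁ * W.v * t ^ 7 - 2 * W.u₁ ^ 2 * W.u₂ * t ^ 9) * (b1 + b2)
  have ks3 : 2 * W.u₁ ^ 2 * W.u₂ * t ^ 5 * dominoDetSV W t * (c 3) = 0 := by
    rw [dominoDetSV]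
    linear_combination (-(t ^ 7) + W.v ^ 4 * t ^ 7 - 2 * W.u₂ ^ 2 * W.v ^ 2 * t ^ 7
        + W.u₂ ^ 4 * t ^ 7 + 2 * W.u₁ * W.u₂ * W.v * t ^ 5 + 2 * W.u₁ * W.u₂ * W.v * t ^ 9
        - 2 * W.u₁ ^ 2 * W.v ^ 2 * t ^ 7 - (W.u₁ ^ 2 * W.u₂ ^ 2 * t ^ 3)
        - (W.u₁ ^ 2 * W.u₂ ^ 2 * t ^ 11) + W.u₁ ^ 2 * W.u₂ ^ 2 * W.w₁ * t ^ 7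
        - (W.u₁ ^ 2 * W.u₂ ^ 2 * W.v ^ 2 * W.w₁ * t ^ 7) + W.u₁ ^ 2 * W.u₂ ^ 4 * W.w₁ * t ^ 7
        + W.u₁ ^ 3 * W.u₂ * W.v * t ^ 5 + W.u₁ ^ 3 * W.u₂ * W.v * t ^ 9
        - (W.u₁ ^ 3 * W.u₂ * W.v ^ 3 * t ^ 5) - (W.u₁ ^ 3 * W.u₂ * W.v ^ 3 * t ^ 9)
        - (W.u₁ ^ 3 * W.u₂ ^ 3 * W.v * t) + W.u₁ ^ 3 * W.u₂ ^ 3 * W.v * t ^ 9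
        + W.u₁ ^ 4 * t ^ 7 - (W.u₁ ^ 4 * W.u₂ ^ 2 * t ^ 7) - (W.u₁ ^ 4 * W.u₂ ^ 2 * t ^ 11)
        - (W.u₁ ^ 4 * W.u₂ ^ 2 * W.w₁ * t ^ 11) + W.u₁ ^ 5 * W.u₂ * W.v * t ^ 5
        + W.u₁ ^ 5 * W.u₂ * W.v * t ^ 9) * (eVS + eUN) + (-(W.u₁ ^ 2 * W.u₂ * t ^ 8)
        - (W.u₁ ^ 2 * W.u₂ * W.w₁ * t ^ 8) + W.u₁ ^ 2 * W.u₂ * W.v ^ 2 * t ^ 4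
        - (W.u₁ ^ 2 * W.u₂ * W.v ^ 2 * W.w₁ * t ^ 8) + W.u₁ ^ 2 * W.u₂ * W.v ^ 4 * t ^ 4
        + W.u₁ ^ 2 * W.u₂ * W.v ^ 4 * t ^ 8 - (W.u₁ ^ 2 * W.u₂ ^ 3 * W.w₁ * t ^ 8)
        - (W.u₁ ^ 2 * W.u₂ ^ 3 * W.v ^ 2 * t ^ 4) - 2 * W.u₁ ^ 2 * W.u₂ ^ 3 * W.v ^ 2 * t ^ 8
        + W.u₁ ^ 2 * W.u₂ ^ 5 * t ^ 8 + W.u₁ ^ 3 * W.u₂ ^ 2 * W.v * t ^ 2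
        + W.u₁ ^ 3 * W.u₂ ^ 2 * W.v * t ^ 6 + W.u₁ ^ 3 * W.u₂ ^ 2 * W.v * W.w₁ * t ^ 6
        + W.u₁ ^ 3 * W.u₂ ^ 2 * W.v * W.w₁ * t ^ 10 + W.u₁ ^ 4 * W.u₂ * t ^ 8
        + W.u₁ ^ 4 * W.u₂ * W.w₁ * t ^ 8 - (W.u₁ ^ 4 * W.u₂ * W.v ^ 2 * t ^ 4)
        - (W.u₁ ^ 4 * W.u₂ * W.v ^ 2 * t ^ 8) - (W.u₁ ^ 4 * W.u₂ ^ 3 * t ^ 4)) * (eVW + eUE) +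
      (-(W.u₁ ^ 2 * W.u₂ * W.v * t ^ 4) + W.u₁ ^ 2 * W.u₂ * W.v * W.w₁ * t ^ 8
          - (W.u₁ ^ 2 * W.u₂ * W.v ^ 3 * t ^ 4) + W.u₁ ^ 2 * W.u₂ * W.v ^ 3 * W.w₁ * t ^ 8
          + W.u₁ ^ 2 * W.u₂ ^ 3 * W.v * t ^ 4 - (W.u₁ ^ 2 * W.u₂ ^ 3 * W.v * W.w₁ * t ^ 8)
          + W.u₁ ^ 3 * W.u₂ ^ 2 * t ^ 10 - (W.u₁ ^ 3 * W.u₂ ^ 2 * W.w₁ * t ^ 6)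
          + W.u₁ ^ 3 * W.u₂ ^ 2 * W.w₁ * t ^ 10 + W.u₁ ^ 3 * W.u₂ ^ 2 * W.v ^ 2 * t ^ 2
          + W.u₁ ^ 3 * W.u₂ ^ 2 * W.v ^ 2 * t ^ 6 + W.u₁ ^ 3 * W.u₂ ^ 2 * W.v ^ 2 * t ^ 10
          - (W.u₁ ^ 3 * W.u₂ ^ 4 * t ^ 10) - (W.u₁ ^ 4 * W.u₂ * W.v * t ^ 4)
          - 2 * W.u₁ ^ 4 * W.u₂ * W.v * t ^ 8 - (W.u₁ ^ 4 * W.u₂ * W.v * W.w₁ * t ^ 8)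
          + W.u₁ ^ 5 * W.u₂ ^ 2 * t ^ 6) * (eVE + eUW) + (t ^ 6 - (W.v ^ 4 * t ^ 6)
          + 2 * W.u₂ ^ 2 * W.v ^ 2 * t ^ 6 - (W.u₂ ^ 4 * t ^ 6) - 2 * W.u₁ * W.u₂ * W.v * t ^ 4
          - 2 * W.u₁ * W.u₂ * W.v * t ^ 8 + 2 * W.u₁ ^ 2 * W.v ^ 2 * t ^ 6
          + W.u₁ ^ 2 * W.u₂ ^ 2 * t ^ 2 + W.u₁ ^ 2 * W.u₂ ^ 2 * t ^ 10
          - (W.u₁ ^ 4 * t ^ 6)) * (b1 + b2)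
  have hA' : t ^ 2 * dominoDetAV W t ≠ 0 := mul_ne_zero (pow_ne_zero 2 ht) hA
  have hS' : 2 * W.u₁ ^ 2 * W.u₂ * t ^ 5 * dominoDetSV W t ≠ 0 :=
    mul_ne_zero (mul_ne_zero (mul_ne_zero (mul_ne_zero two_ne_zero (pow_ne_zero 2 h1)) h2)
      (pow_ne_zero 5 ht)) hS
  have a0 : c 0 - c 6 = 0 := (mul_eq_zero.1 ka0).resolve_left hA'
  have a1 : c 1 - c 5 = 0 := (mul_eq_zero.1 ka1).resolve_left hA'
  have a2 : c 2 - c 4 = 0 := (mul_eq_zero.1 ka2).resolve_left hA'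
  have s0 : c 0 + c 6 = 0 := (mul_eq_zero.1 ks0).resolve_left hS'
  have s1 : c 1 + c 5 = 0 := (mul_eq_zero.1 ks1).resolve_left hS'
  have s2 : c 2 + c 4 = 0 := (mul_eq_zero.1 ks2).resolve_left hS'
  have s3 : c 3 = 0 := (mul_eq_zero.1 ks3).resolve_left hS'
  funext i
  fin_cases i
  · show c 0 = 0
    linear_combination (s0 + a0) / 2
  · show c 1 = 0
    linear_combination (s1 + a1) / 2
  · show c 2 = 0
    linear_combination (s2 + a2) / 2
  · show c 3 = 0
    exact s3
  · show c 4 = 0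
    linear_combination (s2 - a2) / 2
  · show c 5 = 0
    linear_combination (s1 - a1) / 2
  · show c 6 = 0
    linear_combination (s0 - a0) / 2

/-- ★★ Contrapositive: a nonzero VERTICAL two-plaquette identity with `u₁u₂ ≠ 0` lies on
`{dominoDetA = 0} ∪ {dominoDetSV = 0}`. [cite: Glazman2015WeightedSAW, Lemma 3.1 (proof: "solving this linear system")] -/
theorem dominoDetV_eq_zero_of_exists (ht : t ≠ 0) (h1 : W.u₁ ≠ 0) (h2 : W.u₂ ≠ 0)
    (h : ∃ c : Fin 7 → ℂ, c ≠ 0 ∧ ExactDominoVertexRelationV W t c) :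
    dominoDetA W t = 0 ∨ dominoDetSV W t = 0 := by
  obtain ⟨c, hc, hrel⟩ := h
  by_contra hne
  simp only [not_or] at hne
  rw [← dominoDetAV_eq_dominoDetA] at hne
  exact hc (eq_zero_of_exactDominoVertexRelationV ht h1 h2 hne.1 hne.2 hrel)

end GenericV

/-! ## The named statements -/

/-- **Barrier `PlaquetteWalkDominoRowsVertical`** (named statement): the six vertical two-plaquette rows are
NECESSARY for an exact vertical domino relation, at every weight system `W ∈ ℂ⁵` and every phase `t ≠ 0`. A
THEOREM of this file (`PlaquetteWalkDominoRowsVertical_holds`).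

BARRIER (structured block, D-0021):
- technique_class: vertical two-plaquette (domino) constant-coefficient vertex relations `ExactDominoVertexRelationV W t c` of the GM plaquette walk on `ℤ²`
- blocks: every candidate vector violating one of the six vertical rows, at ANY weight system
- because: the relation on the bare vertical two-face list from its six boundary roots is exactly the six rows (twelve `decide` instances of the certified enumerator `termsN`)
- evasions_known: larger face lists impose further conditions (§ GenericV); root-dependent coefficients
- scope_caveats: vertical dominoes; exact constant-coefficient identities; `t = 0` excluded
- status: established — `PlaquetteWalkDominoRowsVertical_holds`; print: the one-rhombus necessity [cite: Glazman2015WeightedSAW, Lemma 3.1]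
[cite: Glazman2015WeightedSAW, Lemma 3.1] -/
def _root_.Literature.Barriers.CriticalPhenomena.PlaquetteWalkDominoRowsVertical : Prop :=
  ∀ (W : CWeights) (t : ℂ) (c : Fin 7 → ℂ),
      t ≠ 0 → ExactDominoVertexRelationV W t c → DominoRowsV W t c

/-- **`PlaquetteWalkDominoRowsVertical` holds.** [cite: Glazman2015WeightedSAW, Lemma 3.1] -/
theorem _root_.Literature.Barriers.CriticalPhenomena.PlaquetteWalkDominoRowsVertical_holds :
    PlaquetteWalkDominoRowsVertical :=
  fun _ _ _ ht h => dominoRowsV_of_exactDominoVertexRelationV h ht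

/-- **Barrier `PlaquetteWalkDominoGenericTrivialityVertical`** (named statement): for `u₁u₂ ≠ 0`, `t ≠ 0`,
every nonzero exact VERTICAL two-plaquette vertex relation lies on the explicit hypersurface
`dominoDetA W t = 0 ∨ dominoDetSV W t = 0`. A THEOREM of this file
(`PlaquetteWalkDominoGenericTrivialityVertical_holds`).

BARRIER (structured block, D-0021):
- technique_class: vertical two-plaquette (domino) constant-coefficient vertex relations `ExactDominoVertexRelationV W t c` of the GM plaquette walk on `ℤ²`
- blocks: every nonzero vertical domino identity with `u₁u₂ ≠ 0` off `{dominoDetA = 0} ∪ {dominoDetSV = 0}` (13- and 21-term explicit polynomials)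
- because: six cleared vertical rows and one `2 × 2`-block instance with its half-turn image, (anti)symmetrised under the half-turn of the vertical domino; adjugate certificates checked by `ring`; the antisymmetric determinant coincides with the horizontal one
- evasions_known: weight systems on the hypersurface; root-dependent coefficients; larger stencils
- scope_caveats: a necessary condition for a nonzero identity only, not claimed sharp; vertical dominoes; `t = 0` excluded
- status: established — `PlaquetteWalkDominoGenericTrivialityVertical_holds`; print: one-plaquette determinants [cite: Glazman2015WeightedSAW, Lemma 3.1] [cite: IkhlefCardy2009, §3]
[cite: Glazman2015WeightedSAW, Lemma 3.1] -/
def _root_.Literature.Barriers.CriticalPhenomena.PlaquetteWalkDominoGenericTrivialityVertical : Prop :=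
  ∀ (W : CWeights) (t : ℂ), t ≠ 0 → W.u₁ ≠ 0 → W.u₂ ≠ 0 →
    (∃ c : Fin 7 → ℂ,
        c ≠ 0 ∧ ExactDominoVertexRelationV W t c) → dominoDetA W t = 0 ∨ dominoDetSV W t = 0

/-- **`PlaquetteWalkDominoGenericTrivialityVertical` holds.** [cite: Glazman2015WeightedSAW, Lemma 3.1] -/
theorem _root_.Literature.Barriers.CriticalPhenomena.PlaquetteWalkDominoGenericTrivialityVertical_holds :
    PlaquetteWalkDominoGenericTrivialityVertical :=
  fun _ _ ht h1 h2 h => dominoDetV_eq_zero_of_exists ht h1 h2 h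

end PlaquetteWalk

end Literature.Barriers.CriticalPhenomena
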